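import Summits.NavierStokesRegularity.NavierStokesRegularity.Theorems.WakeRatchetEternalViscousRateCircuitPumpFarPast
import Summits.NavierStokesRegularity.NavierStokesRegularity.Theorems.TaoLadderRungTwoBreakDSSWaveOfQuadTermDatum

/-!
# `WakeRatchet.EternalViscousRate` (stmt-NavierStokesRegularity-25647): the ACTION CLAUSE for Type-I solutions of a
# viscous Tao circuit — brick 3b of the bridge «`PerpetualPump.CircuitPump` witness ⟹ dissipation-balanced block-DSS
# bounded admissible eternal solution»

For every solution of a viscous Tao circuit on `(-∞,0)` with the PDE-weight Type-I bound (any number of modes, any real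
table; no self-similarity) the physical shell vectors have UNIFORMLY BOUNDED PER-SHELL ACTION in Tao's weight:
`t ↦ ‖x_n(t)‖` is integrable on `(-∞,0)` and `lam^n ∫_{t<0} ‖x_n(t)‖ dt ≤ 2m(C + K₂)` (`action_of_typeI`).  Inputs: Type I
near the blow-up time (`‖x_n‖ ≤ m C lam^{-3n/5}(-t)^{-1/2}`, integrable on `[-s_n, 0)`, `s_n = lam^{-4n/5}`, integral
`2mC lam^{-n}`) and the far-past decay of brick 3a (`WakeRatchetCircuitPumpFarPast.typeI_farPast_bound`:
`‖x_n‖ ≤ m K₂ lam^{-7n/5}(-t)^{-3/2}`, integrable on `(-∞,-s_n)`, integral `2mK₂ lam^{-n}`).  This is exactly hypothesis (hact)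
of `WakeRatchetCircuitPumpAssembly.viscousBlockDSS_of_pumpWitness` (with `lam ^ n` as an integer power); the only input of
that assembly still open is (hbd) = `CircuitPumpNegative.typeI_critical_bound` (module not importable on the farm at the
time of writing).  HONEST LABEL: MODEL lattice ODEs only (Tao 2016 §4); no item is closed; nothing here bears on the
Navier–Stokes equations.
-/

set_option linter.dupNamespace false

noncomputable section

open scoped BigOperators
open Real Set Filter Topology MeasureTheory

namespace Summit.NavierStokesRegularity.NavierStokesRegularity.Theorems.WakeRatchetCircuitPumpAction

open Summit.NavierStokesRegularity.NavierStokesRegularity.Theorems.CircuitPumpNegative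
open Summit.NavierStokesRegularity.NavierStokesRegularity.Theorems.WakeRatchetCircuitPumpClock
open Summit.NavierStokesRegularity.NavierStokesRegularity.Theorems.WakeRatchetCircuitPumpFarPast
open Literature.Analysis.FluidPDE Literature.Analysis.FluidPDE.TaoCascade
open Summit.NavierStokesRegularity.NavierStokesRegularity.Theorems.DSSOneShift (hasDerivWithinAt_shellVec)

variable {m : ℕ}

/-- The near-zero majorant: `t ↦ (-t)^{-1/2}` is integrable on `[-s, 0)` with integral `≤ 2√s` (`s > 0`). [folklore] -/
theorem nearMajorant {s : ℝ} (hs : 0 < s) :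
    IntegrableOn (fun t : ℝ => (-t) ^ (-(1 / 2 : ℝ))) (Ico (-s) 0) ∧
      ∫ t in Ico (-s) 0, (-t) ^ (-(1 / 2 : ℝ)) ≤ 2 * Real.sqrt s := by
  -- interval integrability of `x ↦ x^{-1/2}` on `[0, s]`, reflected
  have h1 : IntervalIntegrable (fun x : ℝ => x ^ (-(1 / 2 : ℝ))) volume 0 s :=
    intervalIntegral.intervalIntegrable_rpow' (by norm_num)
  have h2 : IntervalIntegrable (fun x : ℝ => (-x) ^ (-(1 / 2 : ℝ))) volume (-0) (-s) :=
    (IntervalIntegrable.iff_comp_neg (by simp)).1 h1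
  rw [neg_zero] at h2
  have h3 : IntegrableOn (fun x : ℝ => (-x) ^ (-(1 / 2 : ℝ))) (Icc (-s) 0) := by
    have := h2.symm
    rwa [intervalIntegrable_iff_integrableOn_Icc_of_le (by linarith : -s ≤ 0)] at this
  refine ⟨h3.mono_set Ico_subset_Icc_self, ?_⟩
  -- the value: `∫_{-s}^{0} (-t)^{-1/2} = ∫_0^s x^{-1/2} = 2 s^{1/2}`
  have hval : ∫ t in (-s)..0, (-t) ^ (-(1 / 2 : ℝ)) = 2 * Real.sqrt s := by
    rw [intervalIntegral.integral_comp_neg (fun x : ℝ => x ^ (-(1 / 2 : ℝ)))]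
    simp only [neg_neg, neg_zero]
    rw [integral_rpow (Or.inl (by norm_num))]
    rw [Real.sqrt_eq_rpow]
    norm_num
    ring
  have hIco : ∫ t in Ico (-s) 0, (-t) ^ (-(1 / 2 : ℝ)) = ∫ t in (-s)..0, (-t) ^ (-(1 / 2 : ℝ)) := by
    rw [intervalIntegral.integral_of_le (by linarith : -s ≤ 0), integral_Ico_eq_integral_Ioo,
      integral_Ioc_eq_integral_Ioo]
  rw [hIco, hval]

/-- The far-past majorant: `t ↦ (-t)^{-3/2}` is integrable on `(-∞, -s)` with integral `2/√s` (`s > 0`)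
(change of variables `t = -x` from `integrableOn_Ioi_rpow_of_lt` / `integral_Ioi_rpow_of_lt`). [folklore] -/
theorem farMajorant {s : ℝ} (hs : 0 < s) :
    IntegrableOn (fun t : ℝ => (-t) ^ (-(3 / 2 : ℝ))) (Iio (-s)) ∧
      ∫ t in Iio (-s), (-t) ^ (-(3 / 2 : ℝ)) = 2 / Real.sqrt s := by
  have himg : (fun x : ℝ => -x) '' Ioi s = Iio (-s) := by
    simp
  have hderiv : ∀ x ∈ Ioi s, HasDerivWithinAt (fun x : ℝ => -x) (-1 : ℝ) (Ioi s) x :=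
    fun x _ => (hasDerivAt_neg x).hasDerivWithinAt
  have hinj : InjOn (fun x : ℝ => -x) (Ioi s) := fun x _ y _ h => neg_injective h
  have hI := integrableOn_image_iff_integrableOn_abs_deriv_smul measurableSet_Ioi hderiv hinj
    (fun t : ℝ => (-t) ^ (-(3 / 2 : ℝ)))
  have hE := integral_image_eq_integral_abs_deriv_smul measurableSet_Ioi hderiv hinj
    (fun t : ℝ => (-t) ^ (-(3 / 2 : ℝ)))
  simp only [himg, neg_neg, abs_neg, abs_one, one_smul] at hI hE
  refine ⟨hI.2 (integrableOn_Ioi_rpow_of_lt (by norm_num) hs), ?_⟩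
  rw [hE, integral_Ioi_rpow_of_lt (by norm_num) hs]
  have hs' : s ^ (-(3 / 2 : ℝ) + 1) = (Real.sqrt s)⁻¹ := by
    rw [show (-(3 / 2 : ℝ) + 1) = -(1 / 2 : ℝ) by norm_num, Real.rpow_neg hs.le, Real.sqrt_eq_rpow]
  rw [hs']
  have : Real.sqrt s ≠ 0 := (Real.sqrt_pos.2 hs).ne'
  field_simp
  norm_num

/-- `‖v‖ ≤ Σ_j |v_j|` for a shell vector. [folklore] -/
theorem norm_shellVec_le_sum (X : Fin m → ℤ → ℝ → ℝ) (n : ℤ) (t : ℝ) :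
    ‖shellVec X n t‖ ≤ ∑ j : Fin m, |X j n t| := by
  rw [EuclideanSpace.norm_eq]
  have h0 : ∀ j ∈ (Finset.univ : Finset (Fin m)), 0 ≤ |X j n t| := fun j _ => abs_nonneg _
  calc √(∑ j : Fin m, ‖shellVec X n t j‖ ^ 2) = √(∑ j : Fin m, |X j n t| ^ 2) := by
        simp [shellVec_apply, Real.norm_eq_abs]
    _ ≤ ∑ j : Fin m, |X j n t| := by
        rw [Real.sqrt_le_left (Finset.sum_nonneg h0)]
        exact Finset.sum_sq_le_sq_sum_of_nonneg h0

/-- **Uniform per-shell action of Type-I circuit solutions.**  For every solution of a viscous Tao circuit on `(-∞,0)`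
with the PDE-weight Type-I bound: `t ↦ ‖x_n(t)‖` is integrable on `(-∞,0)` and `lam^n ∫_{t<0}‖x_n‖ ≤ M` for ALL shells `n`,
with `M = 2m(C + K₂)` (`C` the Type-I constant, `K₂` the far-past constant of `typeI_farPast_bound`).
[cite: Tao2016AveragedNS, §4 Thm. 4.2 (statement shape), the viscous equation before it, §6.4; cell vocabulary (action clause of `IsEternalVisc`)] -/
theorem action_of_typeI {lam : ℝ} (hlam : 1 < lam)
    (coeff : Fin m → Fin m → Fin m → Option (Fin 3) → ℝ) (X : Fin m → ℤ → ℝ → ℝ)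
    (hode : SolvesODE lam coeff X) (hTI : IsTypeI lam X) :
    ∃ M : ℝ, ∀ n : ℤ, IntegrableOn (fun t => ‖shellVec X n t‖) (Iio 0) ∧
      lam ^ n * ∫ t in Iio 0, ‖shellVec X n t‖ ≤ M := by
  obtain ⟨K₂, hK₂⟩ := typeI_farPast_bound hlam coeff X hode hTI
  obtain ⟨C, hC⟩ := hTI
  have hpos : 0 < lam := by linarith
  refine ⟨2 * m * (C + K₂), fun n => ?_⟩
  -- signs of the constants (vacuous when there is no mode)
  have hmC : 0 ≤ (m : ℝ) * C := by
    rcases Nat.eq_zero_or_pos m with hm | hm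
    · simp [hm]
    · have i : Fin m := ⟨0, hm⟩
      have h := hC i 0 (-1) (by norm_num)
      have h1 : 0 ≤ lam ^ ((3 / 5 : ℝ) * ((0 : ℤ) : ℝ)) * |X i 0 (-1)| :=
        mul_nonneg (Real.rpow_nonneg hpos.le _) (abs_nonneg _)
      have h2 : (0 : ℝ) ≤ C / Real.sqrt (-(-1 : ℝ)) := h1.trans h
      have hC0 : 0 ≤ C := by simpa using h2
      positivity
  have hmK : 0 ≤ (m : ℝ) * K₂ := by
    rcases Nat.eq_zero_or_pos m with hm | hm
    · simp [hm]
    · have i : Fin m := ⟨0, hm⟩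
      have h := hK₂ i 0 (-1) (by norm_num)
      have h1 : 0 ≤ lam ^ ((7 / 5 : ℝ) * ((0 : ℤ) : ℝ)) * (-(-1 : ℝ) * Real.sqrt (-(-1 : ℝ))) * |X i 0 (-1)| :=
        mul_nonneg (mul_nonneg (Real.rpow_nonneg hpos.le _) (by norm_num)) (abs_nonneg _)
      have hK0 : 0 ≤ K₂ := h1.trans h
      positivity
  -- the crossover time and the two majorant constants at shell `n`
  obtain ⟨s, hsdef, hs⟩ : ∃ s : ℝ, s = lam ^ (-((4 / 5 : ℝ) * n)) ∧ 0 < s := ⟨_, rfl, Real.rpow_pos_of_pos hpos _⟩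
  set A : ℝ := (m : ℝ) * C * lam ^ (-((3 / 5 : ℝ) * n)) with hA
  set B : ℝ := (m : ℝ) * K₂ * lam ^ (-((7 / 5 : ℝ) * n)) with hB
  have hA0 : 0 ≤ A := mul_nonneg hmC (Real.rpow_nonneg hpos.le _)
  have hB0 : 0 ≤ B := mul_nonneg hmK (Real.rpow_nonneg hpos.le _)
  -- pointwise bounds
  have hnear : ∀ t : ℝ, t < 0 → ‖shellVec X n t‖ ≤ A * (-t) ^ (-(1 / 2 : ℝ)) := by
    intro t ht
    have hnt : 0 < -t := neg_pos.2 ht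
    have hcomp : ∀ j : Fin m, |X j n t| ≤ C * lam ^ (-((3 / 5 : ℝ) * n)) * (-t) ^ (-(1 / 2 : ℝ)) := by
      intro j
      have hw : 0 < lam ^ ((3 / 5 : ℝ) * n) := Real.rpow_pos_of_pos hpos _
      have h := hC j n t ht
      rw [mul_comm] at h
      have h' := (le_div_iff₀ hw).2 h
      rw [Real.rpow_neg hpos.le, Real.rpow_neg hnt.le, ← Real.sqrt_eq_rpow]
      calc |X j n t| ≤ C / Real.sqrt (-t) / lam ^ ((3 / 5 : ℝ) * n) := h'
        _ = C * (lam ^ ((3 / 5 : ℝ) * n))⁻¹ * (Real.sqrt (-t))⁻¹ := by ring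
    calc ‖shellVec X n t‖ ≤ ∑ j : Fin m, |X j n t| := norm_shellVec_le_sum X n t
      _ ≤ ∑ _j : Fin m, C * lam ^ (-((3 / 5 : ℝ) * n)) * (-t) ^ (-(1 / 2 : ℝ)) :=
          Finset.sum_le_sum fun j _ => hcomp j
      _ = A * (-t) ^ (-(1 / 2 : ℝ)) := by simp [hA]; ring
  have hfar : ∀ t : ℝ, t < 0 → ‖shellVec X n t‖ ≤ B * (-t) ^ (-(3 / 2 : ℝ)) := by
    intro t ht
    have hnt : 0 < -t := neg_pos.2 ht
    have hsq : 0 < Real.sqrt (-t) := Real.sqrt_pos.2 hnt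
    have h32 : (-t) ^ (-(3 / 2 : ℝ)) = ((-t) * Real.sqrt (-t))⁻¹ := by
      rw [Real.rpow_neg hnt.le, Real.sqrt_eq_rpow,
        show (3 / 2 : ℝ) = 1 + 1 / 2 by norm_num, Real.rpow_add hnt, Real.rpow_one]
    have hcomp : ∀ j : Fin m, |X j n t| ≤ K₂ * lam ^ (-((7 / 5 : ℝ) * n)) * (-t) ^ (-(3 / 2 : ℝ)) := by
      intro j
      have hw : 0 < lam ^ ((7 / 5 : ℝ) * n) := Real.rpow_pos_of_pos hpos _
      have hw2 : 0 < lam ^ ((7 / 5 : ℝ) * n) * ((-t) * Real.sqrt (-t)) := mul_pos hw (mul_pos hnt hsq)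
      have h := hK₂ j n t ht
      rw [h32, Real.rpow_neg hpos.le]
      rw [mul_comm] at h
      have h' := (le_div_iff₀ hw2).2 h
      calc |X j n t| ≤ K₂ / (lam ^ ((7 / 5 : ℝ) * n) * ((-t) * Real.sqrt (-t))) := h'
        _ = K₂ * (lam ^ ((7 / 5 : ℝ) * n))⁻¹ * ((-t) * Real.sqrt (-t))⁻¹ := by
            field_simp
    calc ‖shellVec X n t‖ ≤ ∑ j : Fin m, |X j n t| := norm_shellVec_le_sum X n t
      _ ≤ ∑ _j : Fin m, K₂ * lam ^ (-((7 / 5 : ℝ) * n)) * (-t) ^ (-(3 / 2 : ℝ)) :=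
          Finset.sum_le_sum fun j _ => hcomp j
      _ = B * (-t) ^ (-(3 / 2 : ℝ)) := by simp [hB]; ring
  -- measurability: the shell vector is differentiable, hence continuous, on `t < 0`
  have hcont : ContinuousOn (fun t => ‖shellVec X n t‖) (Iio 0) := by
    refine ContinuousOn.norm fun t ht => ?_
    have hv := hasDerivWithinAt_shellVec (S := univ) (X' := fun i => rhsF lam coeff X i n t)
      fun i => (hode i n t ht).hasDerivWithinAt
    exact (hasDerivWithinAt_univ.1 hv).continuousAt.continuousWithinAt
  have hmeas : ∀ S : Set ℝ, MeasurableSet S → S ⊆ Iio 0 →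
      AEStronglyMeasurable (fun t => ‖shellVec X n t‖) (volume.restrict S) :=
    fun S hS hsub => (hcont.mono hsub).aestronglyMeasurable hS
  -- integrability on the two pieces
  obtain ⟨hN, hNint⟩ := nearMajorant hs
  obtain ⟨hF, hFint⟩ := farMajorant hs
  have hIco : IntegrableOn (fun t => ‖shellVec X n t‖) (Ico (-s) 0) := by
    refine Integrable.mono' (hN.const_mul A) (hmeas _ measurableSet_Ico fun t ht => ht.2) ?_
    refine (ae_restrict_mem measurableSet_Ico).mono fun t ht => ?_
    rw [norm_norm]
    exact hnear t ht.2
  have hIio : IntegrableOn (fun t => ‖shellVec X n t‖) (Iio (-s)) := by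
    refine Integrable.mono' (hF.const_mul B) (hmeas _ measurableSet_Iio fun t ht => ?_) ?_
    · exact lt_trans (mem_Iio.1 ht) (by linarith : -s < 0)
    refine (ae_restrict_mem measurableSet_Iio).mono fun t ht => ?_
    rw [norm_norm]
    exact hfar t (lt_trans (mem_Iio.1 ht) (by linarith : -s < 0))
  have hunion : Iio (-s) ∪ Ico (-s) 0 = Iio 0 := Iio_union_Ico_eq_Iio (by linarith)
  have hdisj : Disjoint (Iio (-s)) (Ico (-s) 0) :=
    Set.disjoint_left.2 fun t h1 h2 => (not_le.2 (mem_Iio.1 h1)) h2.1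
  refine ⟨by rw [← hunion]; exact hIio.union hIco, ?_⟩
  -- the integral
  have hsplit : ∫ t in Iio 0, ‖shellVec X n t‖ =
      (∫ t in Iio (-s), ‖shellVec X n t‖) + ∫ t in Ico (-s) 0, ‖shellVec X n t‖ := by
    rw [← hunion]
    exact setIntegral_union hdisj measurableSet_Ico hIio hIco
  have h1 : ∫ t in Iio (-s), ‖shellVec X n t‖ ≤ B * (2 / Real.sqrt s) := by
    calc ∫ t in Iio (-s), ‖shellVec X n t‖ ≤ ∫ t in Iio (-s), B * (-t) ^ (-(3 / 2 : ℝ)) :=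
          setIntegral_mono_on hIio (hF.const_mul B) measurableSet_Iio
            fun t ht => hfar t (lt_trans (mem_Iio.1 ht) (by linarith : -s < 0))
      _ = B * (2 / Real.sqrt s) := by rw [integral_const_mul, hFint]
  have h2 : ∫ t in Ico (-s) 0, ‖shellVec X n t‖ ≤ A * (2 * Real.sqrt s) := by
    calc ∫ t in Ico (-s) 0, ‖shellVec X n t‖ ≤ ∫ t in Ico (-s) 0, A * (-t) ^ (-(1 / 2 : ℝ)) :=
          setIntegral_mono_on hIco (hN.const_mul A) measurableSet_Ico fun t ht => hnear t ht.2
      _ = A * ∫ t in Ico (-s) 0, (-t) ^ (-(1 / 2 : ℝ)) := integral_const_mul _ _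
      _ ≤ A * (2 * Real.sqrt s) := mul_le_mul_of_nonneg_left hNint hA0
  -- exponent bookkeeping: `lam^n · (A√s + B/√s) = m (C + K₂)`
  have hsq : Real.sqrt s = lam ^ (-((2 / 5 : ℝ) * n)) := by
    rw [hsdef, Real.sqrt_eq_rpow, ← Real.rpow_mul hpos.le]
    congr 1; ring
  have hsq0 : 0 < Real.sqrt s := Real.sqrt_pos.2 hs
  have hzn : (lam ^ n : ℝ) = lam ^ (n : ℝ) := (Real.rpow_intCast lam n).symm
  have e1 : lam ^ (n : ℝ) * (A * Real.sqrt s) = (m : ℝ) * C := by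
    rw [hA, hsq]
    have : lam ^ (n : ℝ) * lam ^ (-((3 / 5 : ℝ) * n)) * lam ^ (-((2 / 5 : ℝ) * n)) = 1 := by
      rw [← Real.rpow_add hpos, ← Real.rpow_add hpos]
      have : (n : ℝ) + -((3 / 5 : ℝ) * n) + -((2 / 5 : ℝ) * n) = 0 := by ring
      rw [this, Real.rpow_zero]
    calc lam ^ (n : ℝ) * ((m : ℝ) * C * lam ^ (-((3 / 5 : ℝ) * n)) * lam ^ (-((2 / 5 : ℝ) * n)))
        = (m : ℝ) * C * (lam ^ (n : ℝ) * lam ^ (-((3 / 5 : ℝ) * n)) * lam ^ (-((2 / 5 : ℝ) * n))) := by ring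
      _ = (m : ℝ) * C := by rw [this, mul_one]
  have e2 : lam ^ (n : ℝ) * (B / Real.sqrt s) = (m : ℝ) * K₂ := by
    rw [hB, hsq, Real.rpow_neg hpos.le ((2 / 5 : ℝ) * n), div_inv_eq_mul]
    have : lam ^ (n : ℝ) * lam ^ (-((7 / 5 : ℝ) * n)) * lam ^ ((2 / 5 : ℝ) * n) = 1 := by
      rw [← Real.rpow_add hpos, ← Real.rpow_add hpos]
      have : (n : ℝ) + -((7 / 5 : ℝ) * n) + (2 / 5 : ℝ) * n = 0 := by ring
      rw [this, Real.rpow_zero]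
    calc lam ^ (n : ℝ) * ((m : ℝ) * K₂ * lam ^ (-((7 / 5 : ℝ) * n)) * lam ^ ((2 / 5 : ℝ) * n))
        = (m : ℝ) * K₂ * (lam ^ (n : ℝ) * lam ^ (-((7 / 5 : ℝ) * n)) * lam ^ ((2 / 5 : ℝ) * n)) := by ring
      _ = (m : ℝ) * K₂ := by rw [this, mul_one]
  have hln : 0 ≤ lam ^ (n : ℝ) := Real.rpow_nonneg hpos.le _
  rw [hzn, hsplit]
  calc lam ^ (n : ℝ) * ((∫ t in Iio (-s), ‖shellVec X n t‖) + ∫ t in Ico (-s) 0, ‖shellVec X n t‖)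
      ≤ lam ^ (n : ℝ) * (B * (2 / Real.sqrt s) + A * (2 * Real.sqrt s)) :=
        mul_le_mul_of_nonneg_left (add_le_add h1 h2) hln
    _ = 2 * (lam ^ (n : ℝ) * (B / Real.sqrt s)) + 2 * (lam ^ (n : ℝ) * (A * Real.sqrt s)) := by ring
    _ = 2 * m * (C + K₂) := by rw [e1, e2]; ring

end Summit.NavierStokesRegularity.NavierStokesRegularity.Theorems.WakeRatchetCircuitPumpAction

end
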